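import Summits.QuantumFields.QCD.Theses.QuarksAsStableAction
import Literature.MathematicalPhysics.QuantumLattice.WilsonDiracAP

/-!
# The route's unquenched weight is REAL (γ₅-hermiticity), in route vocabulary
(crux `QuarksAsStableAction.StableActionBridge`, item stmt-QuantumFields-9737, line `Sketch`; continuation lead c4,
cycle 5; registered sub-goals `apDet_im_eq_zero`, `prod_apDet_im_eq_zero`)

The three open decls of route QuarksAsStableAction (A = `UnquenchedChessboardBound`, S = `WilsonQuarkStability`, and
the rank-2 crux) inline the antiperiodic Wilson-quark determinant
`apDet U m := fermionDet (wilsonDirac (unitaryFundamentalRep (Fin 3) ℂ) (seam-flipped U(3)-lift of U) m 1)`.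
This is DEFINITIONALLY `fermionDet (wilsonDiracAP U m)` of `Literature…WilsonDiracAP` (the lift is `apLift U`), so the
tree's γ₅-hermiticity result `fermionDet_wilsonDiracAP_im` applies verbatim: `apDet U m` is a real number for EVERY
`SU(3)` gauge field `U` and every real bare mass `m`, and so is the `N_f`-flavour unquenched weight `∏_f apDet U (m_f)`
of the SIGNED det-weighted Wilson functional that A is about (real, not positive: one flavour of negative bare mass can
make it negative — barrier `Literature.Barriers.QuantumFields.WilsonDeterminantSign`).
-/

namespace Summit.QuantumFields.QCD.Cruxes.StableActionBridge.Sketch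

open Literature.MathematicalPhysics.QuantumFieldTheory Literature.MathematicalPhysics.QuantumLattice

/-- **The route's antiperiodic Wilson determinant is real**: `Im apDet U m = 0` for every `SU(3)` gauge field `U`
on `(ℤ/L)⁴` and every bare mass `m` (γ₅-hermiticity `γ₅ D_W γ₅ = D_W†` of the Wilson–Dirac operator of the unitary
seam-flipped lift; Montvay–Münster (5.16)). [cite: MontvayMunster1994, §5.1.2 (5.16)] -/
theorem apDet_im_eq_zero : ∀ (L : ℕ) [NeZero L],
    let apDet : GaugeConfig 4 L (Matrix.specialUnitaryGroup (Fin 3) ℂ) → ℝ → ℂ := fun U m =>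
      fermionDet (wilsonDirac (unitaryFundamentalRep (Fin 3) ℂ)
        (fun e => if e.1 e.2 = -1
          then -(⟨(U e).1, Matrix.specialUnitaryGroup_le_unitaryGroup (U e).2⟩ : Matrix.unitaryGroup (Fin 3) ℂ)
          else ⟨(U e).1, Matrix.specialUnitaryGroup_le_unitaryGroup (U e).2⟩) m 1);
    ∀ (U : GaugeConfig 4 L (Matrix.specialUnitaryGroup (Fin 3) ℂ)) (m : ℝ), (apDet U m).im = 0 := by
  intro L _ apDet U m
  exact fermionDet_wilsonDiracAP_im U m

/-- **The `N_f`-flavour unquenched weight is real**: `Im ∏_f apDet U (m_f) = 0` for every `U` and every tuple of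
real bare masses — the det-weighted Wilson functional of `UnquenchedChessboardBound` is a SIGNED REAL functional.
[cite: MontvayMunster1994, §5.1.2 (5.16)] -/
theorem prod_apDet_im_eq_zero : ∀ (L Nf : ℕ) [NeZero L],
    let apDet : GaugeConfig 4 L (Matrix.specialUnitaryGroup (Fin 3) ℂ) → ℝ → ℂ := fun U m =>
      fermionDet (wilsonDirac (unitaryFundamentalRep (Fin 3) ℂ)
        (fun e => if e.1 e.2 = -1
          then -(⟨(U e).1, Matrix.specialUnitaryGroup_le_unitaryGroup (U e).2⟩ : Matrix.unitaryGroup (Fin 3) ℂ)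
          else ⟨(U e).1, Matrix.specialUnitaryGroup_le_unitaryGroup (U e).2⟩) m 1);
    ∀ (U : GaugeConfig 4 L (Matrix.specialUnitaryGroup (Fin 3) ℂ)) (m : Fin Nf → ℝ), (∏ f, apDet U (m f)).im = 0 := by
  intro L Nf _ apDet U m
  have hreal : ∀ f, star (apDet U (m f)) = apDet U (m f) := fun f => star_fermionDet_wilsonDiracAP U (m f)
  have hprod : star (∏ f, apDet U (m f)) = ∏ f, apDet U (m f) := by
    rw [star_prod]
    exact Finset.prod_congr rfl fun f _ => hreal f
  exact Complex.conj_eq_iff_im.1 hprod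

end Summit.QuantumFields.QCD.Cruxes.StableActionBridge.Sketch
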